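import Mathlib
import HarnessLib
import Summits.QuantumFields.YangMills.Theses.PencilRigidity
import Summits.QuantumFields.YangMills.Theorems.PencilRigidityCurvatureKernelBoundKernelOffDiagonalDilation
import Summits.QuantumFields.YangMills.Theorems.PencilRigidityCurvatureKernelBoundKernelOffDiagonalLocal
import Summits.QuantumFields.YangMills.Theorems.PencilRigidityCurvatureKernelBoundKernelOffDiagonalPatch
import Literature.MathematicalPhysics.QuantumFieldTheory.OSPointwiseAnalyticity

/-!
# `CurvatureKernelBound` — stub A3 `KernelOffDiagonal`: the two-point kernel off the diagonal

Crux `stmt-QuantumFields-11687` (`PencilRigidity.CurvatureKernelBound`), line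
`sixteen-charts-analytic-kernel`, stub `KernelOffDiagonal` (A3, assembly).

Given the chart bounds of stub A1 and the tensor-regularity statement of stub A2 (both hypotheses,
both landed), a one-species family `𝔖` on `ℝ⁴` with the OS package, translation invariance on `⁰𝒮`,
invariance under proper signed permutations and reflection positivity in the four diagonal frames of
the `(0,1)`-plane has a two-point kernel `K(x₀ - x₁)` off the diagonal: `K` is continuous on `ℝ⁴ ∖ 0`,
polynomially bounded in `‖x‖, ‖x‖⁻¹`, and `𝔖₂(F) = ∫ K(x₀ - x₁) F(x) dx` for every compactly supported
`F` supported off the diagonal.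

* local kernels of all dilated functionals `𝔖₂ ∘ D_s` near every `(ξ, 0)` (file `…Local`);
* the `s = 1` kernels patch to a difference kernel `K` and a representation on compactly supported
  off-diagonal test functions (file `…Patch`);
* the kernel of `𝔖₂ ∘ D_s` is `s⁸ K(s ·)` (change of variables), so uniqueness of continuous local
  kernels on a finite net of the unit sphere turns the bounds `(C₀ (s + s⁻¹)^q + 1) B` of the local
  kernels into `‖K x‖ ≤ A (‖x‖ᵖ + ‖x‖⁻ᵖ)`.
[folklore]
-/

noncomputable section

open scoped SchwartzMap LineDeriv InnerProductSpace Topology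
open Set MeasureTheory Metric Filter
open Literature.MathematicalPhysics.AQFT Literature.MathematicalPhysics.QuantumLattice
open Literature.MathematicalPhysics.QuantumFieldTheory

namespace Summit.QuantumFields.YangMills.Theorems.CurvatureKernel

/-! ## Dilations and the kernel -/

/-- The trivial dilation. [folklore] -/
theorem dilateTest_one {V : Type*} [NormedAddCommGroup V] [NormedSpace ℝ V] (h : (1 : ℝ) ≠ 0) (F : 𝓢(V, ℂ)) :
    dilateTest 1 h F = F := by
  ext x
  simp [dilateTest_apply]

/-- **Change of variables under dilation** against a difference kernel on `(ℝ⁴)²`: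
`∫ K(x₀ - x₁) F(s⁻¹x) dx = s⁸ ∫ K(s(u₀ - u₁)) F(u) du`. [folklore] -/
theorem integral_kernel_dilateTest (K : EuclideanSpace ℝ (Fin 4) → ℂ)
    (F : 𝓢((Fin 2 → EuclideanSpace ℝ (Fin 4)), ℂ)) {s : ℝ} (hs : 0 < s) :
    ∫ x : Fin 2 → EuclideanSpace ℝ (Fin 4), K (x 0 - x 1) * dilateTest s hs.ne' F x =
      ((s ^ 8 : ℝ) : ℂ) * ∫ u : Fin 2 → EuclideanSpace ℝ (Fin 4), K (s • (u 0 - u 1)) * F u := by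
  have h := Measure.integral_comp_inv_smul_of_nonneg (volume : Measure (Fin 2 → EuclideanSpace ℝ (Fin 4)))
    (fun u : Fin 2 → EuclideanSpace ℝ (Fin 4) => K (s • (u 0 - u 1)) * F u) hs.le
  have hdim : Module.finrank ℝ (Fin 2 → EuclideanSpace ℝ (Fin 4)) = 8 := by
    simp [Module.finrank_pi_fintype]
  rw [hdim, ← Complex.coe_smul, smul_eq_mul] at h
  rw [← h]
  congr 1
  funext x
  simp [smul_sub, smul_inv_smul₀ hs.ne']


/-- Powers of `s + s⁻¹` against powers of `s` and `s⁻¹`: `(s + s⁻¹)ⁿ ≤ 2ⁿ (sⁿ + s⁻ⁿ)`. [folklore] -/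
theorem add_inv_pow_le {s : ℝ} (hs : 0 < s) (n : ℕ) : (s + s⁻¹) ^ n ≤ 2 ^ n * (s ^ n + s⁻¹ ^ n) := by
  have hs' : 0 < s⁻¹ := inv_pos.2 hs
  have h1 : s + s⁻¹ ≤ 2 * max s s⁻¹ := by
    rcases le_total s s⁻¹ with h | h
    · rw [max_eq_right h]; linarith
    · rw [max_eq_left h]; linarith
  have h2 : (max s s⁻¹) ^ n ≤ s ^ n + s⁻¹ ^ n := by
    rcases le_total s s⁻¹ with h | h
    · rw [max_eq_right h]; linarith [pow_nonneg hs.le n]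
    · rw [max_eq_left h]; linarith [pow_nonneg hs'.le n]
  calc (s + s⁻¹) ^ n ≤ (2 * max s s⁻¹) ^ n := pow_le_pow_left₀ (by positivity) h1 n
    _ = 2 ^ n * (max s s⁻¹) ^ n := mul_pow _ _ _
    _ ≤ 2 ^ n * (s ^ n + s⁻¹ ^ n) := by gcongr

/-! ## The polynomial bound from the dilated local kernels -/

/-- **Scaled pointwise bound near a direction.** If `K(x₀ - x₁)` (with `K` continuous off `0`)
represents `T` on compactly supported off-diagonal test functions and, near `(e, 0)`, every dilated
functional `T ∘ D_s` has a continuous local kernel bounded by `b(s)`, then `s⁸ ‖K(s e')‖ ≤ b(s)` for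
`e'` near `e` (the kernel of `T ∘ D_s` is `s⁸ K(s(x₀ - x₁))`, and continuous local kernels are unique).
[folklore] -/
theorem scaled_norm_kernel_le
    (T : 𝓢((Fin 2 → (EuclideanSpace ℝ (Fin 4))), ℂ) →L[ℂ] ℂ) (K : (EuclideanSpace ℝ (Fin 4)) → ℂ) (hK : ContinuousOn K {x | x ≠ 0})
    (hrep : ∀ F : 𝓢((Fin 2 → (EuclideanSpace ℝ (Fin 4))), ℂ), HasCompactSupport (F : (Fin 2 → (EuclideanSpace ℝ (Fin 4))) → ℂ) → tsupport (F : (Fin 2 → (EuclideanSpace ℝ (Fin 4))) → ℂ) ⊆ {x | x 0 ≠ x 1} →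
      Integrable (fun x => K (x 0 - x 1) * F x) ∧ T F = ∫ x, K (x 0 - x 1) * F x)
    (e : (EuclideanSpace ℝ (Fin 4))) (he : e ≠ 0) {ρ : ℝ} (hρ : 0 < ρ) (b : ℝ → ℝ)
    (hloc : ∀ (s : ℝ) (hs : 0 < s), ∃ k : (Fin 2 → (EuclideanSpace ℝ (Fin 4))) → ℂ, ContinuousOn k {x | x 0 ∈ ball e ρ ∧ x 1 ∈ ball 0 ρ} ∧
      (∀ x : (Fin 2 → (EuclideanSpace ℝ (Fin 4))), x 0 ∈ ball e ρ → x 1 ∈ ball 0 ρ → ‖k x‖ ≤ b s) ∧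
      ∀ F : 𝓢((Fin 2 → (EuclideanSpace ℝ (Fin 4))), ℂ), tsupport (F : (Fin 2 → (EuclideanSpace ℝ (Fin 4))) → ℂ) ⊆ {x | x 0 ∈ ball e ρ ∧ x 1 ∈ ball 0 ρ} →
        Integrable (fun x => k x * F x) ∧ T (dilateTest s hs.ne' F) = ∫ x, k x * F x) :
    ∀ (s : ℝ), 0 < s → ∀ e' ∈ ball e (min ρ (‖e‖ / 4)), s ^ 8 * ‖K (s • e')‖ ≤ b s := by
  intro s hs e' he'
  obtain ⟨k, hk, hkb, hkrep⟩ := hloc s hs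
  set r : ℝ := min ρ (‖e‖ / 4) with hr
  have hrρ : r ≤ ρ := min_le_left _ _
  have hre : r ≤ ‖e‖ / 4 := min_le_right _ _
  have hepos : 0 < ‖e‖ := norm_pos_iff.2 he
  set O : Set (Fin 2 → (EuclideanSpace ℝ (Fin 4))) := {x | x 0 ∈ ball e r ∧ x 1 ∈ ball 0 r} with hO
  have hOopen : IsOpen O :=
    ((isOpen_ball (x := e) (ε := r)).preimage (continuous_apply 0 : Continuous fun x : (Fin 2 → (EuclideanSpace ℝ (Fin 4))) => x 0)).and
      ((isOpen_ball (x := (0 : (EuclideanSpace ℝ (Fin 4)))) (ε := r)).preimage (continuous_apply 1 : Continuous fun x : (Fin 2 → (EuclideanSpace ℝ (Fin 4))) => x 1))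
  have hOW : O ⊆ {x | x 0 ∈ ball e ρ ∧ x 1 ∈ ball 0 ρ} := fun x hx =>
    ⟨ball_subset_ball hrρ hx.1, ball_subset_ball hrρ hx.2⟩
  have hOdiag : O ⊆ {x : (Fin 2 → (EuclideanSpace ℝ (Fin 4))) | x 0 ≠ x 1} := by
    intro x hx heq
    obtain ⟨h0, h1⟩ := hx
    rw [mem_ball, dist_eq_norm] at h0 h1
    rw [sub_zero] at h1
    have : ‖e‖ ≤ ‖x 0 - e‖ + ‖x 1‖ := by
      calc ‖e‖ = ‖x 1 - (x 0 - e)‖ := by rw [heq]; congr 1; abel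
        _ ≤ ‖x 1‖ + ‖x 0 - e‖ := norm_sub_le _ _
        _ = ‖x 0 - e‖ + ‖x 1‖ := add_comm _ _
    linarith
  -- the kernel of `T ∘ D_s`
  set κ : (Fin 2 → (EuclideanSpace ℝ (Fin 4))) → ℂ := fun x => ((s ^ 8 : ℝ) : ℂ) * K (s • (x 0 - x 1)) with hκ
  have hκcont : ContinuousOn κ O := by
    refine continuousOn_const.mul (hK.comp ?_ ?_)
    · exact ((continuous_apply 0).sub (continuous_apply 1)).continuousOn.const_smul s
    · intro x hx
      exact smul_ne_zero hs.ne' (sub_ne_zero.2 (hOdiag hx))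
  have hkO : ContinuousOn k O := hk.mono hOW
  have heq : EqOn k κ O := by
    refine eqOn_of_forall_integral_mul_eq hOopen hkO hκcont fun F hF hFc => ?_
    have h1 := (hkrep F (hF.trans hOW)).2
    have hDc : HasCompactSupport ((dilateTest s hs.ne' F : 𝓢((Fin 2 → (EuclideanSpace ℝ (Fin 4))), ℂ)) : (Fin 2 → (EuclideanSpace ℝ (Fin 4))) → ℂ) :=
      hasCompactSupport_dilateTest hs.ne' hFc
    have hDs : tsupport ((dilateTest s hs.ne' F : 𝓢((Fin 2 → (EuclideanSpace ℝ (Fin 4))), ℂ)) : (Fin 2 → (EuclideanSpace ℝ (Fin 4))) → ℂ) ⊆ {x | x 0 ≠ x 1} :=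
      tsupport_dilateTest_subset_offDiagonal hs.ne' (hF.trans hOdiag)
    have h2 := (hrep _ hDc hDs).2
    rw [← h1, h2, integral_kernel_dilateTest K F hs, ← integral_const_mul]
    simp only [hκ, mul_assoc]
  have hmem : (![e', 0] : (Fin 2 → (EuclideanSpace ℝ (Fin 4)))) ∈ O := ⟨he', mem_ball_self (lt_min hρ (by positivity))⟩
  have h := heq hmem
  have hb := hkb _ (hOW hmem).1 (hOW hmem).2
  rw [h] at hb
  simp only [κ, Matrix.cons_val_zero, Matrix.cons_val_one, sub_zero, norm_mul,
    Complex.norm_real, Real.norm_of_nonneg (pow_nonneg hs.le 8)] at hb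
  exact hb

/-- **Polynomial bound on the kernel** from uniformly controlled dilated local kernels near every
direction: a finite net of the unit sphere and `x = ‖x‖ · (x/‖x‖)`. [folklore] -/
theorem exists_polyBound_kernel
    (T : 𝓢((Fin 2 → (EuclideanSpace ℝ (Fin 4))), ℂ) →L[ℂ] ℂ) (K : (EuclideanSpace ℝ (Fin 4)) → ℂ) (hK : ContinuousOn K {x | x ≠ 0})
    (hrep : ∀ F : 𝓢((Fin 2 → (EuclideanSpace ℝ (Fin 4))), ℂ), HasCompactSupport (F : (Fin 2 → (EuclideanSpace ℝ (Fin 4))) → ℂ) → tsupport (F : (Fin 2 → (EuclideanSpace ℝ (Fin 4))) → ℂ) ⊆ {x | x 0 ≠ x 1} →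
      Integrable (fun x => K (x 0 - x 1) * F x) ∧ T F = ∫ x, K (x 0 - x 1) * F x)
    (hloc : ∀ ξ : (EuclideanSpace ℝ (Fin 4)), ξ ≠ 0 → ∃ ρ : ℝ, 0 < ρ ∧ ∃ (B : ℝ) (q : ℕ) (C₀ : ℝ), 0 ≤ C₀ ∧ ∀ (s : ℝ) (hs : 0 < s),
      ∃ k : (Fin 2 → (EuclideanSpace ℝ (Fin 4))) → ℂ, ContinuousOn k {x | x 0 ∈ ball ξ ρ ∧ x 1 ∈ ball 0 ρ} ∧
        (∀ x : (Fin 2 → (EuclideanSpace ℝ (Fin 4))), x 0 ∈ ball ξ ρ → x 1 ∈ ball 0 ρ → ‖k x‖ ≤ (C₀ * (s + s⁻¹) ^ q + 1) * B) ∧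
        ∀ F : 𝓢((Fin 2 → (EuclideanSpace ℝ (Fin 4))), ℂ), tsupport (F : (Fin 2 → (EuclideanSpace ℝ (Fin 4))) → ℂ) ⊆ {x | x 0 ∈ ball ξ ρ ∧ x 1 ∈ ball 0 ρ} →
          Integrable (fun x => k x * F x) ∧ T (dilateTest s hs.ne' F) = ∫ x, k x * F x) :
    ∃ (A : ℝ) (p : ℕ), ∀ x : (EuclideanSpace ℝ (Fin 4)), x ≠ 0 → ‖K x‖ ≤ A * (‖x‖ ^ p + ‖x‖⁻¹ ^ p) := by
  -- pointwise scaled bounds near every direction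
  have claim : ∀ e : (EuclideanSpace ℝ (Fin 4)), e ≠ 0 → ∃ (r : ℝ), 0 < r ∧ ∃ (M : ℝ) (q : ℕ), 0 ≤ M ∧
      ∀ s : ℝ, 0 < s → ∀ e' ∈ ball e r, s ^ 8 * ‖K (s • e')‖ ≤ M * (s + s⁻¹) ^ q := by
    intro e he
    obtain ⟨ρ, hρ, B, q, C₀, hC₀, hs⟩ := hloc e he
    refine ⟨min ρ (‖e‖ / 4), lt_min hρ (by positivity), (C₀ + 1) * |B|, q, by positivity, fun s hs0 e' he' => ?_⟩
    have h := scaled_norm_kernel_le T K hK hrep e he hρ (fun s => (C₀ * (s + s⁻¹) ^ q + 1) * B) hs s hs0 e' he'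
    refine h.trans ?_
    have hL : 1 ≤ (s + s⁻¹) ^ q := one_le_pow₀ (by
      rcases le_or_gt 1 s with h1 | h1; · linarith [inv_pos.2 hs0]
      linarith [(one_le_inv₀ hs0).2 h1.le])
    calc (C₀ * (s + s⁻¹) ^ q + 1) * B ≤ (C₀ * (s + s⁻¹) ^ q + 1) * |B| :=
          mul_le_mul_of_nonneg_left (le_abs_self B) (by positivity)
      _ ≤ ((C₀ + 1) * (s + s⁻¹) ^ q) * |B| := by
          refine mul_le_mul_of_nonneg_right ?_ (abs_nonneg B)
          nlinarith
      _ = (C₀ + 1) * |B| * (s + s⁻¹) ^ q := by ring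
  choose r hr M q hM hbd using claim
  -- a finite net of the unit sphere
  have hsph : ∀ e : (EuclideanSpace ℝ (Fin 4)), e ∈ sphere (0 : (EuclideanSpace ℝ (Fin 4))) 1 → e ≠ 0 := fun e he h0 => by
    rw [mem_sphere_zero_iff_norm, h0, norm_zero] at he
    exact zero_ne_one he
  obtain ⟨t, ht⟩ := (isCompact_sphere (0 : (EuclideanSpace ℝ (Fin 4))) 1).elim_finite_subcover
    (fun e : sphere (0 : (EuclideanSpace ℝ (Fin 4))) 1 => ball (e : (EuclideanSpace ℝ (Fin 4))) (r e (hsph e e.2))) (fun _ => isOpen_ball)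
    (fun e he => mem_iUnion.2 ⟨⟨e, he⟩, mem_ball_self (hr e (hsph e he))⟩)
  set Q : ℕ := t.sup fun e => q e (hsph e e.2) with hQ
  set A₀ : ℝ := ∑ e ∈ t, M e (hsph e e.2) with hA₀
  have hA₀0 : 0 ≤ A₀ := Finset.sum_nonneg fun e _ => hM e _
  refine ⟨A₀ * 2 ^ (Q + 8), Q + 8, fun x hx => ?_⟩
  set s : ℝ := ‖x‖ with hsdef
  have hs : 0 < s := norm_pos_iff.2 hx
  have hL1 : 1 ≤ s + s⁻¹ := by
    rcases le_or_gt 1 s with h1 | h1; · linarith [inv_pos.2 hs]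
    linarith [(one_le_inv₀ hs).2 h1.le]
  set e' : (EuclideanSpace ℝ (Fin 4)) := s⁻¹ • x with he'
  have he'mem : e' ∈ sphere (0 : (EuclideanSpace ℝ (Fin 4))) 1 := by
    rw [mem_sphere_zero_iff_norm, he', norm_smul, norm_inv, norm_norm, inv_mul_cancel₀ hs.ne']
  obtain ⟨i, hi, hxi⟩ := mem_iUnion₂.1 (ht he'mem)
  have hxe : s • e' = x := by rw [he', smul_smul, mul_inv_cancel₀ hs.ne', one_smul]
  have h1 := hbd i (hsph i i.2) s hs e' hxi
  rw [hxe] at h1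
  have hMi : M i (hsph i i.2) ≤ A₀ :=
    Finset.single_le_sum (f := fun e : sphere (0 : (EuclideanSpace ℝ (Fin 4))) 1 => M e (hsph e e.2))
      (fun e _ => hM e _) hi
  have hqi : q i (hsph i i.2) ≤ Q :=
    Finset.le_sup (f := fun e : sphere (0 : (EuclideanSpace ℝ (Fin 4))) 1 => q e (hsph e e.2)) hi
  have h2 : s ^ 8 * ‖K x‖ ≤ A₀ * (s + s⁻¹) ^ Q :=
    h1.trans (mul_le_mul hMi (pow_le_pow_right₀ hL1 hqi) (by positivity) hA₀0)
  have h3 : ‖K x‖ ≤ A₀ * (s + s⁻¹) ^ (Q + 8) := by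
    have h4 : ‖K x‖ = s⁻¹ ^ 8 * (s ^ 8 * ‖K x‖) := by
      rw [← mul_assoc, ← mul_pow, inv_mul_cancel₀ hs.ne', one_pow, one_mul]
    rw [h4, pow_add]
    calc s⁻¹ ^ 8 * (s ^ 8 * ‖K x‖) ≤ (s + s⁻¹) ^ 8 * (A₀ * (s + s⁻¹) ^ Q) :=
          mul_le_mul (pow_le_pow_left₀ (inv_pos.2 hs).le (by linarith) 8) h2 (by positivity) (by positivity)
      _ = A₀ * ((s + s⁻¹) ^ Q * (s + s⁻¹) ^ 8) := by ring
  calc ‖K x‖ ≤ A₀ * (s + s⁻¹) ^ (Q + 8) := h3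
    _ ≤ A₀ * (2 ^ (Q + 8) * (s ^ (Q + 8) + s⁻¹ ^ (Q + 8))) :=
        mul_le_mul_of_nonneg_left (add_inv_pow_le hs _) hA₀0
    _ = A₀ * 2 ^ (Q + 8) * (‖x‖ ^ (Q + 8) + ‖x‖⁻¹ ^ (Q + 8)) := by rw [hsdef]; ring

/-! ## The stub -/

/-- **Stub `KernelOffDiagonal`** (A3 of line `sixteen-charts-analytic-kernel`, crux
`PencilRigidity.CurvatureKernelBound`; registered signature verbatim). See the module docstring for the
statement and the route. [folklore] -/
theorem KernelOffDiagonal : open Literature.MathematicalPhysics.QuantumLattice Literature.MathematicalPhysics.AQFT Literature.MathematicalPhysics.QuantumFieldTheory in (∀ (S₁ : SchwingerFamily (EuclideanSpace ℝ (Fin 4))) (R : (EuclideanSpace ℝ (Fin 4)) ≃ₗᵢ[ℝ] (EuclideanSpace ℝ (Fin 4))), (SchwingerFamily.toLabelled (fun n => (S₁ n).comp (linActMulti R))).IsReflectionPositive → (∀ (n : ℕ) (a : (EuclideanSpace ℝ (Fin 4))) (F : SchwartzMap (Fin n → (EuclideanSpace ℝ (Fin 4))) ℂ), IsOffDiagonal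 F → S₁ n (translateMulti a F) = S₁ n F) → ∃ M₀ : ℕ, ∀ N : ℕ, ∃ (C : ℝ) (p : ℕ), ∀ δ : ℝ, 0 < δ → δ ≤ 1 → ∀ (f g : SchwartzMap (EuclideanSpace ℝ (Fin 4)) ℂ), tsupport (f : (EuclideanSpace ℝ (Fin 4)) → ℂ) ⊆ {x : (EuclideanSpace ℝ (Fin 4)) | inner ℝ x (R (EuclideanSpace.single 0 1)) < 0} → tsupport (g : (EuclideanSpace ℝ (Fin 4)) → ℂ) ⊆ {x : (EuclideanSpace ℝ (Fin 4)) | δ < inner ℝ x (R (EuclideanSpace.single 0 1))} → ∀ F : SchwartzMap (Fin 2 → (EuclideanSpace ℝ (Fin 4))) ℂ, (IsTensorOf F ![((LineDeriv.lineDerivOp (R (EuclideanSpace.single 0 1)) : SchwartzMap (EuclideanSpace ℝ (Fin 4)) ℂ → SchwartzMap (EuclideanSpace ℝ (Fin 4)) ℂ)^[N] f), g] ∨ IsTensorOf F ![f, ((LineDeriv.lineDerivOp (R (EuclideanSpace.single 0 1)) : SchwartzMap (EuclideanSpace ℝ (Fin 4)) ℂ → SchwartzMap (EuclideanSpace ℝ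 (Fin 4)) ℂ)^[N] g)]) → ‖S₁ 2 F‖ ≤ C * (1 / δ) ^ p * schwartzNorm M₀ f * schwartzNorm M₀ g) → (∀ (v : Fin 4 → (EuclideanSpace ℝ (Fin 4))), LinearIndependent ℝ v → ∀ (U V : Set (EuclideanSpace ℝ (Fin 4))), IsOpen U → IsOpen V → ∀ (x₀ y₀ : (EuclideanSpace ℝ (Fin 4))), x₀ ∈ U → y₀ ∈ V → ∀ M₀ : ℕ, ∃ (N₁ : ℕ) (ρ B : ℝ), 0 < ρ ∧ ∀ Λ : SchwartzMap (Fin 2 → (EuclideanSpace ℝ (Fin 4))) ℂ →L[ℂ] ℂ, (∀ (j : Fin 4) (N : ℕ), N ≤ N₁ → ∀ (f g : SchwartzMap (EuclideanSpace ℝ (Fin 4)) ℂ), tsupport (f : (EuclideanSpace ℝ (Fin 4)) → ℂ) ⊆ U → tsupport (g : (EuclideanSpace ℝ (Fin 4)) → ℂ) ⊆ V → ∀ F : SchwartzMap (Fin 2 → (EuclideanSpace ℝ (Fin 4))) ℂ, (IsTensorOf F ![((LineDeriv.lineDerivOp (v j) : SchwartzMap (EuclideanSpace ℝ (Fin 4))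 ℂ → SchwartzMap (EuclideanSpace ℝ (Fin 4)) ℂ)^[N] f), g] ∨ IsTensorOf F ![f, ((LineDeriv.lineDerivOp (v j) : SchwartzMap (EuclideanSpace ℝ (Fin 4)) ℂ → SchwartzMap (EuclideanSpace ℝ (Fin 4)) ℂ)^[N] g)]) → ‖Λ F‖ ≤ schwartzNorm M₀ f * schwartzNorm M₀ g) → ∃ K₂ : (Fin 2 → (EuclideanSpace ℝ (Fin 4))) → ℂ, ContinuousOn K₂ {x : Fin 2 → (EuclideanSpace ℝ (Fin 4)) | x 0 ∈ Metric.ball x₀ ρ ∧ x 1 ∈ Metric.ball y₀ ρ} ∧ (∀ x : Fin 2 → (EuclideanSpace ℝ (Fin 4)), x 0 ∈ Metric.ball x₀ ρ → x 1 ∈ Metric.ball y₀ ρ → ‖K₂ x‖ ≤ B) ∧ ∀ F : SchwartzMap (Fin 2 → (EuclideanSpace ℝ (Fin 4))) ℂ, tsupport (F : (Fin 2 → (EuclideanSpace ℝ (Fin 4))) → ℂ) ⊆ {x : Fin 2 → (EuclideanSpace ℝ (Fin 4)) | x 0 ∈ Metric.ball x₀ ρ ∧ x 1 ∈ Metric.ball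 y₀ ρ} → MeasureTheory.Integrable (fun x : Fin 2 → (EuclideanSpace ℝ (Fin 4)) => K₂ x * F x) ∧ Λ F = ∫ x : Fin 2 → (EuclideanSpace ℝ (Fin 4)), K₂ x * F x) → ∀ (S₁ : SchwingerFamily (EuclideanSpace ℝ (Fin 4))), (S₁.toLabelled.IsNormalized ∧ S₁.toLabelled.IsHermitian ∧ S₁.toLabelled.HasLinearGrowth ∧ S₁.toLabelled.IsReflectionPositive ∧ S₁.toLabelled.IsSymmetric ∧ S₁.toLabelled.HasClusterProperty) → (∀ (n : ℕ) (a : (EuclideanSpace ℝ (Fin 4))) (F : SchwartzMap (Fin n → (EuclideanSpace ℝ (Fin 4))) ℂ), IsOffDiagonal F → S₁ n (translateMulti a F) = S₁ n F) → (∀ (R : (EuclideanSpace ℝ (Fin 4)) ≃ₗᵢ[ℝ] (EuclideanSpace ℝ (Fin 4))), LinearMap.det (R.toLinearEquiv : (EuclideanSpace ℝ (Fin 4)) →ₗ[ℝ] (EuclideanSpace ℝ (Fin 4))) = 1 → (∀ i : Fin 4, ∃ j : Fin 4, R (EuclideanSpace.single i 1) = EuclideanSpace.single j 1 ∨ R (EuclideanSpace.single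 i 1) = -EuclideanSpace.single j 1) → ∀ (n : ℕ) (F : SchwartzMap (Fin n → (EuclideanSpace ℝ (Fin 4))) ℂ), IsOffDiagonal F → S₁ n (linActMulti R F) = S₁ n F) → (∀ (R : (EuclideanSpace ℝ (Fin 4)) ≃ₗᵢ[ℝ] (EuclideanSpace ℝ (Fin 4))) (a b : ℝ), a ^ 2 = 1 / 2 → b ^ 2 = 1 / 2 → R (EuclideanSpace.single 0 1) = a • EuclideanSpace.single 0 1 + b • EuclideanSpace.single 1 1 → (SchwingerFamily.toLabelled (fun n => (S₁ n).comp (linActMulti R))).IsReflectionPositive) → ∃ K : (EuclideanSpace ℝ (Fin 4)) → ℂ, ContinuousOn K {x : (EuclideanSpace ℝ (Fin 4)) | x ≠ 0} ∧ (∃ (A : ℝ) (p : ℕ), ∀ x : (EuclideanSpace ℝ (Fin 4)), x ≠ 0 → ‖K x‖ ≤ A * (‖x‖ ^ p + ‖x‖⁻¹ ^ p)) ∧ ∀ F : SchwartzMap (Fin 2 → (EuclideanSpace ℝ (Fin 4))) ℂ, HasCompactSupport (F : (Fin 2 → (EuclideanSpace ℝ (Fin 4))) → ℂ) → tsupport (F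 : (Fin 2 → (EuclideanSpace ℝ (Fin 4))) → ℂ) ⊆ {x : Fin 2 → (EuclideanSpace ℝ (Fin 4)) | x 0 ≠ x 1} → MeasureTheory.Integrable (fun x : Fin 2 → (EuclideanSpace ℝ (Fin 4)) => K (x 0 - x 1) * F x) ∧ S₁ 2 F = ∫ x : Fin 2 → (EuclideanSpace ℝ (Fin 4)), K (x 0 - x 1) * F x := by
  intro hA1 hA2 S₁ hOS hT hH hD
  obtain ⟨-, -, -, hE2, -, -⟩ := hOS
  have hloc := fun (ξ : (EuclideanSpace ℝ (Fin 4))) (hξ : ξ ≠ 0) => exists_local_kernels hA1 hA2 S₁ hE2 hT hH hD ξ hξ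
  have hT2 : ∀ (a : (EuclideanSpace ℝ (Fin 4))) (F : 𝓢((Fin 2 → (EuclideanSpace ℝ (Fin 4))), ℂ)), IsOffDiagonal F → S₁ 2 (translateMulti a F) = S₁ 2 F :=
    fun a F hF => hT 2 a F hF
  -- the difference kernel from the `s = 1` local kernels
  obtain ⟨K, hKcont, hKloc⟩ := exists_differenceKernel_of_local (S₁ 2) hT2 (fun ξ hξ => by
    obtain ⟨ρ, hρ, B, q, C₀, -, hs⟩ := hloc ξ hξ
    obtain ⟨k, hk, -, hkrep⟩ := hs 1 one_pos
    refine ⟨ρ, k, hρ, hk, fun F hF => ?_⟩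
    have h := hkrep F hF
    rwa [dilateTest_one] at h)
  -- representation of compactly supported off-diagonal test functions
  have hΩ : IsOpen {x : (Fin 2 → (EuclideanSpace ℝ (Fin 4))) | x 0 ≠ x 1} := isOpen_ne_fun (continuous_apply 0) (continuous_apply 1)
  have hκ : ContinuousOn (fun x : (Fin 2 → (EuclideanSpace ℝ (Fin 4))) => K (x 0 - x 1)) {x | x 0 ≠ x 1} :=
    hKcont.comp ((continuous_apply 0).sub (continuous_apply 1)).continuousOn fun x hx => sub_ne_zero.2 hx
  have hrepK : ∀ F : 𝓢((Fin 2 → (EuclideanSpace ℝ (Fin 4))), ℂ), HasCompactSupport (F : (Fin 2 → (EuclideanSpace ℝ (Fin 4))) → ℂ) → tsupport (F : (Fin 2 → (EuclideanSpace ℝ (Fin 4))) → ℂ) ⊆ {x | x 0 ≠ x 1} →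
      Integrable (fun x => K (x 0 - x 1) * F x) ∧ S₁ 2 F = ∫ x, K (x 0 - x 1) * F x := by
    intro F hFc hF
    refine integral_rep_of_local (S₁ 2) hΩ (fun x => K (x 0 - x 1)) hκ (fun z hz => ?_) F hFc hF
    obtain ⟨ρ, hρ, hρrep⟩ := hKloc z hz
    have hzpos : 0 < ‖z 0 - z 1‖ := norm_pos_iff.2 (sub_ne_zero.2 hz)
    set ρ' : ℝ := min ρ (‖z 0 - z 1‖ / 4) with hρ'
    have hρ'pos : 0 < ρ' := lt_min hρ (by positivity)
    refine ⟨{x | x 0 ∈ ball (z 0) ρ' ∧ x 1 ∈ ball (z 1) ρ'}, ?_, ⟨mem_ball_self hρ'pos, mem_ball_self hρ'pos⟩, ?_,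
      fun G hG _ => hρrep G (hG.trans fun x hx =>
        ⟨ball_subset_ball (min_le_left _ _) hx.1, ball_subset_ball (min_le_left _ _) hx.2⟩)⟩
    · exact ((isOpen_ball (x := z 0) (ε := ρ')).preimage (continuous_apply 0 : Continuous fun x : (Fin 2 → (EuclideanSpace ℝ (Fin 4))) => x 0)).and
        ((isOpen_ball (x := z 1) (ε := ρ')).preimage (continuous_apply 1 : Continuous fun x : (Fin 2 → (EuclideanSpace ℝ (Fin 4))) => x 1))
    · intro x hx heq
      obtain ⟨h0, h1⟩ := hx
      rw [mem_ball, dist_eq_norm] at h0 h1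
      have hle : ρ' ≤ ‖z 0 - z 1‖ / 4 := min_le_right _ _
      have : ‖z 0 - z 1‖ ≤ ‖x 0 - z 0‖ + ‖x 1 - z 1‖ := by
        calc ‖z 0 - z 1‖ = ‖(x 1 - z 1) - (x 0 - z 0)‖ := by rw [heq]; congr 1; abel
          _ ≤ ‖x 1 - z 1‖ + ‖x 0 - z 0‖ := norm_sub_le _ _
          _ = ‖x 0 - z 0‖ + ‖x 1 - z 1‖ := add_comm _ _
      linarith
  exact ⟨K, hKcont, exists_polyBound_kernel (S₁ 2) K hKcont hrepK hloc, hrepK⟩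

/-- **Sub-goal `KernelOffDiagonalLet`**: the stub `KernelOffDiagonal` in `let E := ℝ⁴` form (the same
proposition up to unfolding the `let`; registered because the expanded statement of the stub exceeds
the ledger's 4000-character limit for stub signatures and was stored truncated). [folklore] -/
theorem KernelOffDiagonalLet : open Literature.MathematicalPhysics.QuantumLattice Literature.MathematicalPhysics.AQFT Literature.MathematicalPhysics.QuantumFieldTheory in let E := EuclideanSpace ℝ (Fin 4); (∀ (S₁ : SchwingerFamily E) (R : E ≃ₗᵢ[ℝ] E), (SchwingerFamily.toLabelled (fun n => (S₁ n).comp (linActMulti R))).IsReflectionPositive → (∀ (n : ℕ) (a : E) (F : SchwartzMap (Fin n → E) ℂ), IsOffDiagonal F → S₁ n (translateMulti a F) = S₁ n F) → ∃ M₀ : ℕ, ∀ N : ℕ, ∃ (C : ℝ) (p : ℕ), ∀ δ : ℝ, 0 < δ → δ ≤ 1 → ∀ (f g : SchwartzMap E ℂ), tsupport (f : E → ℂ) ⊆ {x : E | inner ℝ x (R (EuclideanSpace.single 0 1)) < 0} → tsupport (g : E → ℂ) ⊆ {x : E | δ < inner ℝ x (R (EuclideanSpace.single 0 1))} → ∀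 F : SchwartzMap (Fin 2 → E) ℂ, (IsTensorOf F ![((LineDeriv.lineDerivOp (R (EuclideanSpace.single 0 1)) : SchwartzMap E ℂ → SchwartzMap E ℂ)^[N] f), g] ∨ IsTensorOf F ![f, ((LineDeriv.lineDerivOp (R (EuclideanSpace.single 0 1)) : SchwartzMap E ℂ → SchwartzMap E ℂ)^[N] g)]) → ‖S₁ 2 F‖ ≤ C * (1 / δ) ^ p * schwartzNorm M₀ f * schwartzNorm M₀ g) → (∀ (v : Fin 4 → E), LinearIndependent ℝ v → ∀ (U V : Set E), IsOpen U → IsOpen V → ∀ (x₀ y₀ : E), x₀ ∈ U → y₀ ∈ V → ∀ M₀ : ℕ, ∃ (N₁ : ℕ) (ρ B : ℝ), 0 < ρ ∧ ∀ Λ : SchwartzMap (Fin 2 → E) ℂ →L[ℂ] ℂ, (∀ (j : Fin 4) (N : ℕ), N ≤ N₁ → ∀ (f g : SchwartzMap E ℂ), tsupport (f : E → ℂ) ⊆ U → tsupport (g : E → ℂ) ⊆ V → ∀ F : SchwartzMap (Fin 2 → E) ℂ, (IsTensorOf F ![((LineDeriv.lineDerivOp (v j) : SchwartzMap E ℂ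 → SchwartzMap E ℂ)^[N] f), g] ∨ IsTensorOf F ![f, ((LineDeriv.lineDerivOp (v j) : SchwartzMap E ℂ → SchwartzMap E ℂ)^[N] g)]) → ‖Λ F‖ ≤ schwartzNorm M₀ f * schwartzNorm M₀ g) → ∃ K₂ : (Fin 2 → E) → ℂ, ContinuousOn K₂ {x : Fin 2 → E | x 0 ∈ Metric.ball x₀ ρ ∧ x 1 ∈ Metric.ball y₀ ρ} ∧ (∀ x : Fin 2 → E, x 0 ∈ Metric.ball x₀ ρ → x 1 ∈ Metric.ball y₀ ρ → ‖K₂ x‖ ≤ B) ∧ ∀ F : SchwartzMap (Fin 2 → E) ℂ, tsupport (F : (Fin 2 → E) → ℂ) ⊆ {x : Fin 2 → E | x 0 ∈ Metric.ball x₀ ρ ∧ x 1 ∈ Metric.ball y₀ ρ} → MeasureTheory.Integrable (fun x : Fin 2 → E => K₂ x * F x) ∧ Λ F = ∫ x : Fin 2 → E, K₂ x * F x) → ∀ (S₁ : SchwingerFamily E), (S₁.toLabelled.IsNormalized ∧ S₁.toLabelled.IsHermitian ∧ S₁.toLabelled.HasLinearGrowth ∧ S₁.toLabelled.IsReflectionPositive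 ∧ S₁.toLabelled.IsSymmetric ∧ S₁.toLabelled.HasClusterProperty) → (∀ (n : ℕ) (a : E) (F : SchwartzMap (Fin n → E) ℂ), IsOffDiagonal F → S₁ n (translateMulti a F) = S₁ n F) → (∀ (R : E ≃ₗᵢ[ℝ] E), LinearMap.det (R.toLinearEquiv : E →ₗ[ℝ] E) = 1 → (∀ i : Fin 4, ∃ j : Fin 4, R (EuclideanSpace.single i 1) = EuclideanSpace.single j 1 ∨ R (EuclideanSpace.single i 1) = -EuclideanSpace.single j 1) → ∀ (n : ℕ) (F : SchwartzMap (Fin n → E) ℂ), IsOffDiagonal F → S₁ n (linActMulti R F) = S₁ n F) → (∀ (R : E ≃ₗᵢ[ℝ] E) (a b : ℝ), a ^ 2 = 1 / 2 → b ^ 2 = 1 / 2 → R (EuclideanSpace.single 0 1) = a • EuclideanSpace.single 0 1 + b • EuclideanSpace.single 1 1 → (SchwingerFamily.toLabelled (fun n => (S₁ n).comp (linActMulti R))).IsReflectionPositive) → ∃ K : E → ℂ, ContinuousOn K {x : E | x ≠ 0} ∧ (∃ (A : ℝ) (p : ℕ), ∀ x : E, x ≠ 0 → ‖K x‖ ≤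 A * (‖x‖ ^ p + ‖x‖⁻¹ ^ p)) ∧ ∀ F : SchwartzMap (Fin 2 → E) ℂ, HasCompactSupport (F : (Fin 2 → E) → ℂ) → tsupport (F : (Fin 2 → E) → ℂ) ⊆ {x : Fin 2 → E | x 0 ≠ x 1} → MeasureTheory.Integrable (fun x : Fin 2 → E => K (x 0 - x 1) * F x) ∧ S₁ 2 F = ∫ x : Fin 2 → E, K (x 0 - x 1) * F x := by
  intro E
  exact KernelOffDiagonal

end Summit.QuantumFields.YangMills.Theorems.CurvatureKernel

end
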